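import Summits.ResolutionOfSingularities.ResolutionOfSingularities.Theorems.WildConesCampaignW46HypersurfacesCharTwoEmbDim

/-!
# [OURS · L1 W4.6, rung (ii) at p = 2, EVERY dimension n] The embedding dimension of a double point:
# `e = 0 ⇔ μ = 1`, `e = 1 ⇒ μ` even and Milnor algebra `κ⟦X⟧/(X^μ)`, `OrdP ⇔ e ≤ n − 2`, and for
# threefolds `e ≤ 1 ⇔ OrdP` — over every field of characteristic 2

HONEST FRAMING. Everything here is OURS: theorems about route WildCones' own TYPED point-blow-up
dynamics (`Theorems/WildConesClassicalRegimesDefs.lean`: a state is the coefficient function `c` of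
`a = Σ c(A) u^A`, the atom is `z² = a(u₁,…,uₙ)`; `step` = blow up the closed point, chart `u_i`, divide by
`u_i²`, translate by `τ`, delete square monomials; `MultP` = cleaned order `≥ 2` (a double point), `OrdP`
= a cleaned monomial of degree `2` (a hyperbolic pair `u_j u_l`), `Isol` = finite Milnor algebra
`κ⟦u⟧/(∂a)`, `mu` = its dimension) and the two numbers of
`Theorems/WildConesCampaignW46HypersurfacesCharTwoEmbDimDefs.lean` (p498937): `jetTwoColength f =
dim_κ κ⟦X⟧/((∂f) + 𝔪²)` and `milnorEmbDim p n κ c = jetTwoColength (ser c) - 1 =` the EMBEDDING DIMENSION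
`e(c)` of the Milnor algebra (for a double point in characteristic `2`: the corank of the polar form of
the cleaned quadratic part). NOTHING here is a statement of the manuscript [Hironaka2017] and nothing of
it is used; no FACT-LIST premise is used (the hyperbolic-pair splitting of Greuel–Pfister is a kernel
theorem of the tree, `WildCones.MuDropCharTwoOrdP.pair_reduction` / `descent` / `descent_step`). AI
review is weaker than expert review. Cell res-hironaka (LADDER-RESOLUTION rung L, D-0089), slot W4.6
«restricted regimes as rungs», seat res-L1-s46-pv-4 (gen 3): «(ii) THREEFOLD HYPERSURFACES, second
prover: the p = 2 hyperbolic-splitting regime of `ClassicalRegimes` (n ≥ 3, order-2 cleaned states)».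
Host: route `WildCones`, crux `ClassicalRegimes` (stmt-ResolutionOfSingularities-16884; proved).
Second of three files (`…EmbDim`, this, `…EmbDimDynamics`).

WHAT IS NEW (every `n`, every field of characteristic `2`):

* `finrank_eq_one_of_jetTwoColength_eq_one` / `jetTwoColength_eq_one_of_finrank_eq_one`, at state level
  `milnorEmbDim_eq_zero_iff` — EMBEDDING DIMENSION ZERO ⇔ MILNOR NUMBER ONE (non-degenerate polar form;
  `n` even): the residual has no variables, the Milnor algebra is `κ`.
* `curvilinear_of_jetTwoColength_eq_two`, at state level `curvilinear_of_milnorEmbDim_eq_one` — EMBEDDING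
  DIMENSION ONE (polar form of corank one; `n` odd): `μ` is EVEN, `μ ≥ 2`, and the Milnor algebra is
  `κ⟦X⟧/(X^μ)` — gen 2's `threefold_mu_even` / `threefold_milnorAlgebra_equiv` in every dimension.
* `milnorEmbDim_le_and_mod_two` — `e(c) ≤ n`, `e(c) ≡ n (mod 2)` for every double state;
  `ordP_iff_milnorEmbDim_add_two_le` — `OrdP c ↔ e(c) + 2 ≤ n`; `not_ordP_iff_milnorEmbDim_eq` — cleaned
  order `≥ 3 ↔ e(c) = n`.
* `threefold_milnorEmbDim_le_one_iff_ordP`, `threefold_milnorEmbDim_eq` — for `n = 3`: `e ≤ 1 ↔ OrdP`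
  (then `e = 1`), `¬OrdP ↔ e = 3`: the gen-2 regime IS the `n = 3` instance of the regime `e ≤ 1`.

VACUITY. `e` takes every value allowed by parity: `e = 1` on `z² = u₀u₁ + u₂^(2j+1)` (p470498), `e = 3`
on the Fermat cubic (p483423) — both by `threefold_milnorEmbDim_eq`; `e = 0` on `z² = u₀u₁` (`n = 2`,
`μ = 1`) by `milnorEmbDim_eq_zero_iff`.

References: G.-M. Greuel, G. Pfister, The splitting lemma in any characteristic, J. Algebra 689 (2026)
= arXiv:2507.17078, Thm 3.5 / Cor 3.7 [GreuelPfister2026] (through the tree's `pair_reduction`,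
`descent`, `descent_step`); H. Hironaka, ms. 2017-03-23 [Hironaka2017], Th. 16.6 p.84, Th. 16.13 p.87 —
quoted for the ROLE replaced only, under adjudication, not cited as fact.
-/

noncomputable section

-- single-problem summit: the doubled namespace component `ResolutionOfSingularities` is forced
set_option linter.dupNamespace false

open scoped BigOperators Classical

open MvPowerSeries IsLocalRing

open Literature.AlgebraicGeometry.Resolution

namespace Summit.ResolutionOfSingularities.ResolutionOfSingularities.Theorems

namespace CampaignW46.HypersurfacesCharTwo

open WildCones WildCones.MuDropCharTwoOrdP ThreefoldsCharTwo

variable {κ : Type} [Field κ]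

/-- `dim_κ κ⟦⟧ = 1` (no variables). [folklore] -/
theorem finrank_mvPowerSeries_fin_zero : Module.finrank κ (MvPowerSeries (Fin 0) κ) = 1 := by
  have e : MvPowerSeries (Fin 0) κ ≃ₗ[κ] κ := LinearEquiv.funUnique (Fin 0 →₀ ℕ) κ κ
  rw [e.finrank_eq, Module.finrank_self]

/-- [OURS · L1 W4.6] **Embedding dimension zero means Milnor number one** (characteristic two):
`jetTwoColength f = 1` for `f` of order `≥ 2` forces a FINITE Milnor algebra of dimension `1`
(`(∂f) = 𝔪`; the residual has no variables). [folklore] -/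
theorem finrank_eq_one_of_jetTwoColength_eq_one [CharP κ 2] {n : ℕ} {f : MvPowerSeries (Fin n) κ}
    (hf : 2 ≤ f.order) (h : jetTwoColength f = 1) :
    Module.Finite κ (MvPowerSeries (Fin n) κ ⧸
        Ideal.span (Set.range fun s => MvPowerSeries.pderiv s f)) ∧
      Module.finrank κ (MvPowerSeries (Fin n) κ ⧸
        Ideal.span (Set.range fun s => MvPowerSeries.pderiv s f)) = 1 := by
  obtain ⟨m, g, -, -, hg, hnp, ⟨ε⟩, -⟩ := exists_residual n f hf
  have hm : m = 0 := by
    rw [jetTwoColength_eq_of_residual hg hnp ε] at h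
    omega
  subst hm
  have hbot : Ideal.span (Set.range fun t : Fin 0 => MvPowerSeries.pderiv t g) = ⊥ := by
    rw [Set.range_eq_empty, Ideal.span_empty]
  let ε' : (MvPowerSeries (Fin n) κ ⧸ Ideal.span (Set.range fun s => MvPowerSeries.pderiv s f))
      ≃ₐ[κ] MvPowerSeries (Fin 0) κ :=
    (ε.trans (Ideal.quotientEquivAlgOfEq κ hbot)).trans (AlgEquiv.quotientBot κ _)
  haveI : Module.Finite κ (MvPowerSeries (Fin 0) κ) :=
    Module.finite_of_finrank_pos (by rw [finrank_mvPowerSeries_fin_zero]; exact one_pos)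
  exact ⟨Module.Finite.equiv ε'.symm.toLinearEquiv,
    by rw [ε'.toLinearEquiv.finrank_eq, finrank_mvPowerSeries_fin_zero]⟩

/-- [OURS · L1 W4.6] Conversely, **Milnor number one means embedding dimension zero**: a finite
Milnor algebra of dimension `1` has `jetTwoColength f = 1` (for `f` of order `≥ 2`, characteristic
two). [folklore] -/
theorem jetTwoColength_eq_one_of_finrank_eq_one [CharP κ 2] {n : ℕ} {f : MvPowerSeries (Fin n) κ}
    (hf : 2 ≤ f.order)
    (hfin : Module.Finite κ (MvPowerSeries (Fin n) κ ⧸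
      Ideal.span (Set.range fun s => MvPowerSeries.pderiv s f)))
    (h1 : Module.finrank κ (MvPowerSeries (Fin n) κ ⧸
      Ideal.span (Set.range fun s => MvPowerSeries.pderiv s f)) = 1) :
    jetTwoColength f = 1 := by
  have hle : jetTwoColength f ≤ 1 := by
    haveI := hfin
    rw [← h1]
    have hIJ : Ideal.span (Set.range fun s => MvPowerSeries.pderiv s f) ≤
        Ideal.span (Set.range fun s => MvPowerSeries.pderiv s f) ⊔
          maximalIdeal (MvPowerSeries (Fin n) κ) ^ 2 := le_sup_left
    refine LinearMap.finrank_le_finrank_of_surjective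
      (f := (Ideal.Quotient.factorₐ κ hIJ).toLinearMap) fun x => ?_
    obtain ⟨a, rfl⟩ := Ideal.Quotient.mk_surjective x
    exact ⟨Ideal.Quotient.mk _ a, rfl⟩
  have := (jetTwoColength_range hf).1
  omega

/-- [OURS · L1 W4.6] **Embedding dimension one: the curvilinear case** (characteristic two): if
`jetTwoColength f = 2` for `f` of order `≥ 2` with finite Milnor algebra, then the Milnor number
`μ = dim_κ κ⟦X⟧/(∂f)` is EVEN, `μ ≥ 2`, and the Milnor algebra is `κ⟦X⟧/(X^μ)` (the residual has one
variable; the curve leaf `curve_milnor_even`, `curve_span_pderiv_eq_span_X_pow`). [folklore] -/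
theorem curvilinear_of_jetTwoColength_eq_two [CharP κ 2] {n : ℕ} {f : MvPowerSeries (Fin n) κ}
    (hf : 2 ≤ f.order) (h : jetTwoColength f = 2)
    (hfin : Module.Finite κ (MvPowerSeries (Fin n) κ ⧸
      Ideal.span (Set.range fun s => MvPowerSeries.pderiv s f))) :
    Even (Module.finrank κ (MvPowerSeries (Fin n) κ ⧸
        Ideal.span (Set.range fun s => MvPowerSeries.pderiv s f))) ∧
      2 ≤ Module.finrank κ (MvPowerSeries (Fin n) κ ⧸
        Ideal.span (Set.range fun s => MvPowerSeries.pderiv s f)) ∧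
      Nonempty ((MvPowerSeries (Fin n) κ ⧸
          Ideal.span (Set.range fun s => MvPowerSeries.pderiv s f)) ≃ₐ[κ]
        (MvPowerSeries (Fin 1) κ ⧸ Ideal.span {(X 0 : MvPowerSeries (Fin 1) κ) ^
          Module.finrank κ (MvPowerSeries (Fin n) κ ⧸
            Ideal.span (Set.range fun s => MvPowerSeries.pderiv s f))})) := by
  obtain ⟨m, g, -, -, hg, hnp, ⟨ε⟩, -⟩ := exists_residual n f hf
  have hm : m = 1 := by
    rw [jetTwoColength_eq_of_residual hg hnp ε] at h
    omega
  subst hm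
  haveI := hfin
  have hfin' : Module.Finite κ (MvPowerSeries (Fin 1) κ ⧸
      Ideal.span (Set.range fun t => MvPowerSeries.pderiv t g)) :=
    Module.Finite.equiv ε.toLinearEquiv
  rw [ε.toLinearEquiv.finrank_eq]
  refine ⟨curve_milnor_even hfin', ?_,
    ⟨ε.trans (Ideal.quotientEquivAlgOfEq κ (curve_span_pderiv_eq_span_X_pow hfin'))⟩⟩
  -- `μ ≥ 2`: even and positive
  have hne : Ideal.span (Set.range fun t => MvPowerSeries.pderiv t g) ≠ ⊤ := by
    intro htop
    have hle : Ideal.span (Set.range fun t => MvPowerSeries.pderiv t g) ≤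
        maximalIdeal (MvPowerSeries (Fin 1) κ) := by
      rw [Ideal.span_le]
      rintro _ ⟨t, rfl⟩
      exact Ideal.pow_le_self two_ne_zero (pderiv_mem_maximalIdeal_sq
        ((FormalCoordChange.two_le_order_iff _).mp hg).2 hnp t)
    exact (maximalIdeal.isMaximal (MvPowerSeries (Fin 1) κ)).ne_top (top_le_iff.mp (htop ▸ hle))
  haveI : Nontrivial (MvPowerSeries (Fin 1) κ ⧸
      Ideal.span (Set.range fun t => MvPowerSeries.pderiv t g)) := Ideal.Quotient.nontrivial_iff.mpr hne
  have hpos := Module.finrank_pos (R := κ) (M := MvPowerSeries (Fin 1) κ ⧸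
      Ideal.span (Set.range fun t => MvPowerSeries.pderiv t g))
  obtain ⟨k, hk⟩ := curve_milnor_even hfin'
  omega

/-! ## States of the dynamics: the embedding dimension of a double point -/

section States

variable {n : ℕ}

/-- [OURS · L1 W4.6] `milnorEmbDim` through the route's Jacobian ideal: `e(c) + 1 = dim_κ κ⟦u⟧/((∂a) + 𝔪²)`
as soon as that colength is positive (it is, for a double point: `milnorEmbDim_le`). [folklore] -/
theorem milnorEmbDim_def (p : ℕ) (c : (Fin n → ℕ) → κ) :
    milnorEmbDim p n κ c = Module.finrank κ (MvPowerSeries (Fin n) κ ⧸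
      (jac p n κ c ⊔ maximalIdeal (MvPowerSeries (Fin n) κ) ^ 2)) - 1 := by
  rw [milnorEmbDim, jetTwoColength, jac_eq_span_pderiv]

/-- [OURS · L1 W4.6; NOT a statement of the manuscript] **RANGE AND PARITY of the embedding
dimension of a double point** (`z² = a(u₁,…,uₙ)`, any field of characteristic `2`): for a state of
multiplicity two, `e(c) ≤ n` and `e(c) ≡ n (mod 2)` — the polar form of the cleaned quadratic part is
alternating, so its rank `n - e(c)` is even. In particular `e = 1` or `3` for threefolds (`n = 3`),
`e ∈ {0, 2, 4}` for fourfolds. [folklore] -/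
theorem milnorEmbDim_le_and_mod_two [CharP κ 2] {c : (Fin n → ℕ) → κ} (hM : MultP 2 n κ c) :
    milnorEmbDim 2 n κ c ≤ n ∧ milnorEmbDim 2 n κ c % 2 = n % 2 ∧
      jetTwoColength (ser 2 n κ c) = milnorEmbDim 2 n κ c + 1 := by
  have h := jetTwoColength_range (two_le_order_ser hM)
  unfold milnorEmbDim
  omega

/-- [OURS · L1 W4.6; NOT a statement of the manuscript] **`OrdP` READ OFF THE EMBEDDING DIMENSION**
(every `n`, characteristic `2`): a double state is order-2 cleaned (a hyperbolic pair `u_j u_l` in the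
cleaned quadratic form) iff `e(c) + 2 ≤ n`; it has cleaned order `≥ 3` iff `e(c) = n`. [folklore] -/
theorem ordP_iff_milnorEmbDim_add_two_le [CharP κ 2] {c : (Fin n → ℕ) → κ} (hM : MultP 2 n κ c) :
    OrdP 2 n κ c ↔ milnorEmbDim 2 n κ c + 2 ≤ n := by
  rw [ordP_two_iff_exists_pair, exists_pair_iff_jetTwoColength (two_le_order_ser hM)]
  have h := (milnorEmbDim_le_and_mod_two hM).2.2
  omega

/-- [OURS · L1 W4.6; NOT a statement of the manuscript] Cleaned order `≥ 3` (`¬ OrdP`) iff the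
embedding dimension is maximal, `e(c) = n` (all partials in `𝔪²`). [folklore] -/
theorem not_ordP_iff_milnorEmbDim_eq [CharP κ 2] {c : (Fin n → ℕ) → κ} (hM : MultP 2 n κ c) :
    ¬ OrdP 2 n κ c ↔ milnorEmbDim 2 n κ c = n := by
  rw [ordP_iff_milnorEmbDim_add_two_le hM]
  have h := (milnorEmbDim_le_and_mod_two hM)
  omega

/-- [OURS · L1 W4.6 rung (ii) at `p = 2`; NOT a statement of the manuscript] **THREEFOLDS: the
hyperbolic-splitting regime `e ≤ 1` IS the order-2-cleaned regime `OrdP`** — for a double state of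
`z² = a(u₀,u₁,u₂)` over any field of characteristic `2`, `e(c) ≤ 1 ↔ OrdP c` (and then `e(c) = 1`):
the regime of gen 2's files (p479260 … p485613) is the `n = 3` instance of the regime `e ≤ 1` of every
dimension. [folklore] -/
theorem threefold_milnorEmbDim_le_one_iff_ordP [CharP κ 2] {c : (Fin 3 → ℕ) → κ} (hM : MultP 2 3 κ c) :
    milnorEmbDim 2 3 κ c ≤ 1 ↔ OrdP 2 3 κ c := by
  rw [ordP_iff_milnorEmbDim_add_two_le hM]
  omega

/-- [OURS · L1 W4.6; NOT a statement of the manuscript] For threefolds, `OrdP` double states have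
`e(c) = 1` exactly and the others `e(c) = 3`. [folklore] -/
theorem threefold_milnorEmbDim_eq [CharP κ 2] {c : (Fin 3 → ℕ) → κ} (hM : MultP 2 3 κ c) :
    (OrdP 2 3 κ c → milnorEmbDim 2 3 κ c = 1) ∧ (¬ OrdP 2 3 κ c → milnorEmbDim 2 3 κ c = 3) := by
  rw [ordP_iff_milnorEmbDim_add_two_le hM]
  have h := milnorEmbDim_le_and_mod_two hM
  omega

/-- [OURS · L1 W4.6; NOT a statement of the manuscript] **EMBEDDING DIMENSION ZERO ⇔ MILNOR NUMBER
ONE** (every `n`, characteristic `2`): a double state with `e(c) = 0` (NON-DEGENERATE polar form — only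
possible for EVEN `n`) is an isolated singularity with `μ = 1`; conversely an isolated double state with
`μ = 1` has `e(c) = 0`. [folklore] -/
theorem milnorEmbDim_eq_zero_iff [CharP κ 2] {c : (Fin n → ℕ) → κ} (hM : MultP 2 n κ c) :
    milnorEmbDim 2 n κ c = 0 ↔ Isol 2 n κ c ∧ mu 2 n κ c = 1 := by
  have h := milnorEmbDim_le_and_mod_two hM
  rw [isol_iff_finite_pderiv, mu_eq_finrank_pderiv]
  constructor
  · intro h0
    exact finrank_eq_one_of_jetTwoColength_eq_one (two_le_order_ser hM) (by omega)
  · rintro ⟨hI, h1⟩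
    have := jetTwoColength_eq_one_of_finrank_eq_one (two_le_order_ser hM) hI h1
    omega

/-- [OURS · L1 W4.6; NOT a statement of the manuscript] **EMBEDDING DIMENSION ONE: the CURVILINEAR
isolated double points** (every `n`, characteristic `2`): an isolated double state with `e(c) = 1` (polar
form of corank one — only possible for ODD `n`) has EVEN Milnor number `μ ≥ 2` and Milnor algebra
`κ⟦u⟧/(∂a) ≅ κ⟦X⟧/(X^μ)`. For `n = 3` this is gen 2's `threefold_mu_even` / `threefold_milnorAlgebra_equiv`
(there `e = 1 ↔ OrdP`). [cite: GreuelPfister2026, Thm 3.5 and Cor 3.7] -/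
theorem curvilinear_of_milnorEmbDim_eq_one [CharP κ 2] {c : (Fin n → ℕ) → κ} (hM : MultP 2 n κ c)
    (hI : Isol 2 n κ c) (h1 : milnorEmbDim 2 n κ c = 1) :
    Even (mu 2 n κ c) ∧ 2 ≤ mu 2 n κ c ∧
      Nonempty ((MvPowerSeries (Fin n) κ ⧸ jac 2 n κ c) ≃ₐ[κ]
        (MvPowerSeries (Fin 1) κ ⧸ Ideal.span {(X 0 : MvPowerSeries (Fin 1) κ) ^ mu 2 n κ c})) := by
  have h := milnorEmbDim_le_and_mod_two hM
  rw [isol_iff_finite_pderiv] at hI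
  rw [mu_eq_finrank_pderiv, jac_eq_span_pderiv]
  exact curvilinear_of_jetTwoColength_eq_two (two_le_order_ser hM) (by omega) hI

end States

end CampaignW46.HypersurfacesCharTwo

end Summit.ResolutionOfSingularities.ResolutionOfSingularities.Theorems

end
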